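import Literature.Probability.Distributions.FiniteProductLaws
import HarnessLib

/-!
# Events of a finite independent family: product rule and union bound

`Literature/Probability/Distributions/`, theorems-only companion of `FiniteProductLaws.lean` (`piLaw P`,
the law of an independent family indexed by a finite type, each coordinate a law on a finite type,
and its identification with `Measure.pi`, `toOuterMeasure_piLaw_apply`). The two estimates every
"repeat the experiment `N` times independently" argument uses (e.g. the `N = poly(n)` iterations of the
first component of Peikert's `GapSVP → LWE` reduction, `Literature.Computability.Cryptography.PeikertReduction`:
NO case by a union bound over the iterations, YES case by the product rule):

* `piLaw_toOuterMeasure_forall_mem` — **product rule**: `Pr[∀ j, Xⱼ ∈ Sⱼ] = ∏ⱼ Pr[Xⱼ ∈ Sⱼ]`;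
* `piLaw_toOuterMeasure_eval_mem` — marginals: `Pr[Xⱼ ∈ S] = Pⱼ(S)`;
* `piLaw_toOuterMeasure_exists_mem_le` — **union bound**: `Pr[∃ j, Xⱼ ∈ Sⱼ] ≤ ∑ⱼ Pr[Xⱼ ∈ Sⱼ]`;
* `piLaw_toOuterMeasure_forall_mem_le_pow` — if each `Pr[Xⱼ ∈ Sⱼ] ≤ θ` then `Pr[∀ j, Xⱼ ∈ Sⱼ] ≤ θ^N`.

All [folklore].
-/

noncomputable section

namespace Literature.Probability.Distributions

open _root_.MeasureTheory Finset
open scoped ENNReal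

variable {ι : Type*} {κ : ι → Type*} [Fintype ι] [DecidableEq ι] [∀ i, Fintype (κ i)]

/-- **Product rule** for an independent finite family: the probability that every coordinate lands in
its prescribed set is the product of the marginal probabilities. [folklore] -/
theorem piLaw_toOuterMeasure_forall_mem (P : ∀ i, PMF (κ i)) (S : ∀ i, Set (κ i)) :
    (piLaw P).toOuterMeasure {f | ∀ i, f i ∈ S i} = ∏ i, (P i).toOuterMeasure (S i) := by
  letI : ∀ i, MeasurableSpace (κ i) := fun _ => ⊤
  haveI : ∀ i, MeasurableSingletonClass (κ i) := fun _ => ⟨fun _ => trivial⟩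
  have hset : {f : ∀ i, κ i | ∀ i, f i ∈ S i} = Set.pi Set.univ S := by
    ext f; simp
  rw [toOuterMeasure_piLaw_apply, hset, Measure.pi_pi]
  exact Finset.prod_congr rfl fun i _ => (P i).toMeasure_apply_eq_toOuterMeasure _

/-- **Marginals**: the probability that coordinate `j` lands in `S` is `Pⱼ(S)`. [folklore] -/
theorem piLaw_toOuterMeasure_eval_mem (P : ∀ i, PMF (κ i)) (j : ι) (S : Set (κ j)) :
    (piLaw P).toOuterMeasure {f | f j ∈ S} = (P j).toOuterMeasure S := by
  classical
  have hset : {f : ∀ i, κ i | f j ∈ S} = {f | ∀ i, f i ∈ Function.update (fun i => (Set.univ : Set (κ i))) j S i} := by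
    ext f
    simp only [Set.mem_setOf_eq]
    constructor
    · intro hf i
      by_cases hij : i = j
      · subst hij; simpa using hf
      · rw [Function.update_of_ne hij]; exact Set.mem_univ _
    · intro hf
      simpa using hf j
  rw [hset, piLaw_toOuterMeasure_forall_mem, ← Finset.mul_prod_erase _ _ (Finset.mem_univ j)]
  simp only [Function.update_self]
  rw [Finset.prod_eq_one, mul_one]
  intro i hi
  rw [Function.update_of_ne (Finset.ne_of_mem_erase hi), PMF.toOuterMeasure_apply_eq_one_iff]
  exact Set.subset_univ _

/-- **Union bound** for an independent finite family (independence is not even needed): the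
probability that some coordinate lands in its set is at most the sum of the marginal probabilities.
[folklore] -/
theorem piLaw_toOuterMeasure_exists_mem_le (P : ∀ i, PMF (κ i)) (S : ∀ i, Set (κ i)) :
    (piLaw P).toOuterMeasure {f | ∃ i, f i ∈ S i} ≤ ∑ i, (P i).toOuterMeasure (S i) := by
  have hset : {f : ∀ i, κ i | ∃ i, f i ∈ S i} = ⋃ i, {f | f i ∈ S i} := by
    ext f; simp
  rw [hset]
  refine (measure_iUnion_fintype_le _ _).trans ?_
  exact Finset.sum_le_sum fun i _ => (piLaw_toOuterMeasure_eval_mem P i (S i)).le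

/-- **Independent repetition**: if each coordinate lands in its set with probability `≤ θ`, all of them
do so with probability `≤ θ^N` (`N` the number of coordinates). [folklore] -/
theorem piLaw_toOuterMeasure_forall_mem_le_pow (P : ∀ i, PMF (κ i)) (S : ∀ i, Set (κ i)) {θ : ℝ≥0∞}
    (h : ∀ i, (P i).toOuterMeasure (S i) ≤ θ) :
    (piLaw P).toOuterMeasure {f | ∀ i, f i ∈ S i} ≤ θ ^ Fintype.card ι := by
  rw [piLaw_toOuterMeasure_forall_mem, ← Finset.card_univ, ← Finset.prod_const]
  exact Finset.prod_le_prod' fun i _ => h i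

end Literature.Probability.Distributions

end
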